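import Mathlib.Geometry.Manifold.GroupLieAlgebra
import Mathlib.Geometry.Manifold.IntegralCurve.UniformTime
import Mathlib.Geometry.Manifold.IntegralCurve.Transform
import Mathlib.Topology.Algebra.OpenSubgroup
import Literature.Geometry.Manifold.CompleteFlow
import Literature.Geometry.Manifold.InverseFunctionTheorem
import HarnessLib

/-!
# The exponential map of a Lie group (Lee 2012, Thm. 9.18, Thm. 20.1, Prop. 20.5, Prop. 20.8)

General Lie theory for Mathlib's `LieGroup I ∞ G` over a **real** model with corners `I`
(complete model space `E`, `G` Hausdorff and without boundary points): the one-parameter subgroups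
and the exponential map `exp : 𝔤 → G`, `𝔤 = GroupLieAlgebra I G = T_1 G` (carried by `E`), built
from the flow of the left-invariant vector fields `mulInvariantVectorField v` of
`Mathlib.Geometry.Manifold.GroupLieAlgebra` and the tree's fundamental theorem on flows for
complete fields (`Literature.Geometry.Manifold.contMDiff_of_isMIntegralCurve_family`).

* `Literature.Geometry.Manifold.contMDiff_tangentBundle_mk` — the inclusion `w ↦ (x, w)` of a
  tangent space into the tangent bundle is `C^∞` (any manifold).
* `Literature.Geometry.Manifold.isMIntegralCurveOn_mul_left` (and `…At`, global versions) — left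
  translations carry integral curves of a left-invariant field to integral curves (Lee 2012,
  Prop. 9.6 for `L_g`; proof of Thm. 20.1); `contMDiff_mulInvariantVectorField_infty` /
  `contMDiff_mulInvariantVectorField_prod` — `X_v(g)` is `C^∞` in `g` and jointly in `(g, v)`.
* `Literature.Geometry.Manifold.exists_isMIntegralCurve_mulInvariantVectorField` — **left-invariant
  vector fields are complete** (Lee 2012, Thm. 9.18): a local integral curve through `1` is
  translated to every point, giving a uniform time of existence, whence global existence by
  Mathlib's uniform-time lemma `exists_isMIntegralCurve_of_isMIntegralCurveOn` (Lee 2012, Lemma 9.15).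
* `Literature.Geometry.Manifold.lieExpCurve v` — the one-parameter subgroup generated by `v ∈ 𝔤`
  (the integral curve of `mulInvariantVectorField v` through `1`), with uniqueness
  (`eq_mul_lieExpCurve_of_isMIntegralCurve`: the flow of `X_v` is right multiplication by
  `lieExpCurve v t`, Lee 2012, Prop. 20.8 (h)), the homomorphism law
  `lieExpCurve_add : lieExpCurve v (s + t) = lieExpCurve v s * lieExpCurve v t` (Thm. 20.1) and the
  rescaling law `lieExpCurve_smul` (Lemma 9.3 / Prop. 20.5).
* `Literature.Geometry.Manifold.lieExp v := lieExpCurve v 1` — the exponential map, with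
  `lieExpCurve_eq_lieExp_smul : lieExpCurve v t = lieExp (t • v)` (Prop. 20.5), `lieExp_add_smul`,
  `lieExp_neg`, `lieExp_natCast_smul`, `lieExp_intCast_smul` (Prop. 20.8 (b)–(d)),
  `hasMFDerivAt_lieExpCurve_zero` (`γ_v'(0) = v`).
* Smoothness (Prop. 20.8 (a)): `contMDiff_mul_lieExpCurve` (`(g, t) ↦ g exp(tv)`),
  `contMDiff_lieExpCurve_uncurry` (`(v, t) ↦ exp(tv)`, via the flow of Lee's auxiliary field
  `Ξ(g, v) = (X_v(g), 0)` on `G × 𝔤`: `contMDiff_expField`, `isMIntegralCurve_expField`) and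
  `contMDiff_lieExp` (`exp` is `C^∞` on `𝔤`).
* `Literature.Geometry.Manifold.mfderiv_lieExp_zero` / `hasMFDerivAt_lieExp_zero` — `(d exp)_0 = id`
  (Prop. 20.8 (e)); `isLocalDiffeomorphAt_lieExp` — `exp` is a `C^∞` local diffeomorphism at `0`
  (Prop. 20.8 (f), by the tree's inverse function theorem on manifolds
  `Literature.Geometry.Manifold.isLocalDiffeomorphAt_of_mfderiv`; here `I` boundaryless),
  `range_lieExp_mem_nhds_one` (`exp 𝔤` is a neighbourhood of `1`) and
  `subgroupClosure_range_lieExp` (`exp 𝔤` generates a connected `G`; Lee 2012, Prop. 7.14).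
* Commutative groups: `mfderiv_mul_mulInvariantVectorField`, `lieExpCurve_add_left`,
  `lieExp_add : lieExp (v + w) = lieExp v * lieExp w`, `lieExp_sub` (Lee 2012, Problem 20-8;
  false for non-commutative `G`); `exists_nhds_injOn_lieExp`, `eventually_lieExp_eq_one_imp_eq_zero`
  (`exp` injective near `0`, kernel discrete; any `G`), `isOpenMap_lieExp` (commutative `G`) and
  `lieExp_surjective` for connected commutative `G` (Lee 2012, Problem 21-20 (a)).

Everything is proved; no named facts. The two definitions (`lieExpCurve`, `lieExp`) are total:
`Classical.epsilon` of "global integral curve of `X_v` through `1`", which exists and is unique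
under the standing hypotheses. Naturality (Prop. 20.8 (g)): `map_lieExpCurve`, `map_lieExp`
(`Φ (exp v) = exp (dΦ_1 v)` for a differentiable `MonoidHom`). Not here: the closed-subgroup
theorem.

## References

* J. M. Lee, *Introduction to Smooth Manifolds*, 2nd ed., GTM 218 (2012), Thm. 9.18 (left-invariant
  fields are complete), Thm. 20.1, Prop. 20.5, Prop. 20.8, Prop. 7.14, Problem 20-8 (held: `lit read
  book:lee2012-introduction-smooth-manifolds`, pp. 544–549). [LeeSmoothManifolds2013]
-/

open scoped Manifold ContDiff Topology
open Set Function Filter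

noncomputable section

namespace Literature.Geometry.Manifold

universe u

section TangentInclusion

variable {E : Type u} [NormedAddCommGroup E] [NormedSpace ℝ E]
  {H : Type*} [TopologicalSpace H] {I : ModelWithCorners ℝ E H}
  {M : Type*} [TopologicalSpace M] [ChartedSpace H M] [IsManifold I ∞ M]

/-- **The inclusion of a tangent space into the tangent bundle is smooth**: for a fixed base point
`x`, `w ↦ (x, w) ∈ TM` is `C^∞` (in the natural coordinates `(xⁱ, vⁱ)` of `TM` over the chart at
`x` it is `w ↦ (x, w)` on the nose, `tangentCoordChange_self`). [cite: LeeSmoothManifolds2013, Prop. 3.18] -/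
theorem contMDiff_tangentBundle_mk (x : M) :
    ContMDiff 𝓘(ℝ, E) I.tangent ∞
      (fun w : E => (Bundle.TotalSpace.mk' E x w : TangentBundle I M)) := by
  intro w
  rw [Bundle.contMDiffAt_totalSpace]
  refine ⟨contMDiffAt_const, ?_⟩
  have key : (fun w' : E =>
      (trivializationAt E (TangentSpace I) x (Bundle.TotalSpace.mk' E x w')).2) = id := by
    funext w'
    rw [TangentBundle.trivializationAt_apply]
    exact tangentCoordChange_self (I := I) (mem_extChartAt_source x)
  show ContMDiffAt 𝓘(ℝ, E) 𝓘(ℝ, E) ∞ (fun w' : E =>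
      (trivializationAt E (TangentSpace I) x (Bundle.TotalSpace.mk' E x w')).2) w
  rw [key]
  exact contMDiffAt_id

end TangentInclusion

section LieExp

variable {E : Type u} [NormedAddCommGroup E] [NormedSpace ℝ E]
  {H : Type*} [TopologicalSpace H] {I : ModelWithCorners ℝ E H}
  {G : Type*} [TopologicalSpace G] [ChartedSpace H G] [Group G]

/-! ### Left-invariant vector fields and left translations -/

/-- The left-invariant vector field generated by `v ∈ T_1 G` takes the value `v` at the identity.
[cite: LeeSmoothManifolds2013, Thm. 8.37] -/
theorem mulInvariantVectorField_one (v : GroupLieAlgebra I G) :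
    mulInvariantVectorField v (1 : G) = v := by
  have h : (fun x : G => (1 : G) * x) = id := funext one_mul
  show mfderiv I I (fun x : G => (1 : G) * x) (1 : G) v = v
  rw [h, mfderiv_id]
  rfl

variable [LieGroup I ∞ G]

/-- Left translation `L_g` maps the left-invariant field at `h` to the left-invariant field at
`g * h` (`X_v` is `L_g`-related to itself). [cite: LeeSmoothManifolds2013, Thm. 8.37] -/
theorem mfderiv_mul_left_mulInvariantVectorField (v : GroupLieAlgebra I G) (g h : G) :
    mfderiv I I (g * ·) h (mulInvariantVectorField v h) = mulInvariantVectorField v (g * h) := by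
  have hc : (fun x : G => g * h * x) = (fun x : G => g * x) ∘ (fun x : G => h * x) := by
    ext x; simp only [comp_apply, mul_assoc]
  have key := mfderiv_comp_apply_of_eq (I := I) (I' := I) (I'' := I) (1 : G)
    (g := fun x : G => g * x) (f := fun x : G => h * x)
    mdifferentiableAt_mul_left mdifferentiableAt_mul_left (mul_one h) v
  rw [← hc] at key
  exact key.symm

/-- **Left translations carry integral curves of a left-invariant vector field to integral curves**
(on a set). [cite: LeeSmoothManifolds2013, Prop. 9.6] -/
theorem isMIntegralCurveOn_mul_left {v : GroupLieAlgebra I G} {γ : ℝ → G} {s : Set ℝ}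
    (hγ : IsMIntegralCurveOn γ (mulInvariantVectorField v) s) (g : G) :
    IsMIntegralCurveOn (fun t => g * γ t) (mulInvariantVectorField v) s := by
  intro t ht
  have h1 : HasMFDerivAt I I (fun x : G => g * x) (γ t) (mfderiv I I (fun x : G => g * x) (γ t)) :=
    mdifferentiableAt_mul_left.hasMFDerivAt
  have h2 : HasMFDerivWithinAt 𝓘(ℝ, ℝ) I (fun t => g * γ t) s t
      ((mfderiv I I (fun x : G => g * x) (γ t)).comp
        ((1 : ℝ →L[ℝ] ℝ).smulRight (mulInvariantVectorField v (γ t)))) :=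
    h1.comp_hasMFDerivWithinAt t (hγ t ht)
  have he : (mfderiv I I (fun x : G => g * x) (γ t)).comp
      ((1 : ℝ →L[ℝ] ℝ).smulRight (mulInvariantVectorField v (γ t))) =
      (1 : ℝ →L[ℝ] ℝ).smulRight (mulInvariantVectorField v (g * γ t)) := by
    apply ContinuousLinearMap.ext_ring
    simp only [ContinuousLinearMap.comp_apply, ContinuousLinearMap.smulRight_apply,
      one_apply_eq_self, one_smul, mfderiv_mul_left_mulInvariantVectorField]
  exact h2.congr_mfderiv he

/-- Left translations carry global integral curves of a left-invariant vector field to global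
integral curves. [cite: LeeSmoothManifolds2013, Prop. 9.6] -/
theorem isMIntegralCurve_mul_left {v : GroupLieAlgebra I G} {γ : ℝ → G}
    (hγ : IsMIntegralCurve γ (mulInvariantVectorField v)) (g : G) :
    IsMIntegralCurve (fun t => g * γ t) (mulInvariantVectorField v) := by
  rw [isMIntegralCurve_iff_isMIntegralCurveOn] at hγ ⊢
  exact isMIntegralCurveOn_mul_left hγ g

/-- Left translations carry local integral curves of a left-invariant vector field to local
integral curves. [cite: LeeSmoothManifolds2013, Prop. 9.6] -/
theorem isMIntegralCurveAt_mul_left {v : GroupLieAlgebra I G} {γ : ℝ → G} {t₀ : ℝ}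
    (hγ : IsMIntegralCurveAt γ (mulInvariantVectorField v) t₀) (g : G) :
    IsMIntegralCurveAt (fun t => g * γ t) (mulInvariantVectorField v) t₀ := by
  rw [isMIntegralCurveAt_iff] at hγ ⊢
  obtain ⟨s, hs, h⟩ := hγ
  exact ⟨s, hs, isMIntegralCurveOn_mul_left h g⟩

set_option backward.defeqAttrib.useBackward true in
/-- A left-invariant vector field of a `C^∞` Lie group is a `C^∞` section of the tangent bundle
(Mathlib's `contMDiff_mulInvariantVectorField` records only the `C^2` class needed for the Lie
bracket; the same proof gives every class). [cite: LeeSmoothManifolds2013, Prop. 8.33 and Thm. 8.37] -/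
theorem contMDiff_mulInvariantVectorField_infty (v : GroupLieAlgebra I G) :
    ContMDiff I I.tangent ∞ (fun g : G => (mulInvariantVectorField v g : TangentBundle I G)) := by
  let fg : G → TangentBundle I G := fun g => Bundle.TotalSpace.mk' E g 0
  have sfg : ContMDiff I I.tangent ∞ fg := Bundle.contMDiff_zeroSection _ _
  let fv : G → TangentBundle I G := fun _ => Bundle.TotalSpace.mk' E (1 : G) v
  have sfv : ContMDiff I I.tangent ∞ fv := contMDiff_const
  let F₁ : G → TangentBundle I G × TangentBundle I G := fun g => (fg g, fv g)
  have S₁ : ContMDiff I (I.tangent.prod I.tangent) ∞ F₁ := sfg.prodMk sfv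
  let F₂ : TangentBundle I G × TangentBundle I G → TangentBundle (I.prod I) (G × G) :=
    (equivTangentBundleProd I G I G).symm
  have S₂ : ContMDiff (I.tangent.prod I.tangent) (I.prod I).tangent ∞ F₂ :=
    contMDiff_equivTangentBundleProd_symm
  let F₃ : TangentBundle (I.prod I) (G × G) → TangentBundle I G :=
    tangentMap (I.prod I) I (fun p : G × G => p.1 * p.2)
  have S₃ : ContMDiff (I.prod I).tangent I.tangent ∞ F₃ :=
    ContMDiff.contMDiff_tangentMap (contMDiff_mul I ∞) (m := ∞) (by exact le_of_eq (by simp))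
  have S := (S₃.comp S₂).comp S₁
  convert! S with g
  · simp [F₁, F₂, F₃, fg, fv]
  · simp only [comp_apply, tangentMap, F₃, F₂, F₁, fg, fv]
    rw [mfderiv_prod_eq_add_apply ((contMDiff_mul I ∞).mdifferentiableAt (by simp))]
    simp +instances [mulInvariantVectorField]

/-- A left-invariant vector field is a `C^1` section of the tangent bundle (the class used by the
existence and uniqueness theorems for integral curves). [cite: LeeSmoothManifolds2013, Prop. 8.33] -/
theorem contMDiff_mulInvariantVectorField_one (v : GroupLieAlgebra I G) :
    ContMDiff I I.tangent 1 (fun g : G => (mulInvariantVectorField v g : TangentBundle I G)) :=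
  (contMDiff_mulInvariantVectorField_infty v).of_le (by exact_mod_cast le_top)

/-! ### Completeness of left-invariant vector fields (Lee 2012, Thm. 9.18) -/

variable [CompleteSpace E] [T2Space G] [BoundarylessManifold I G]

/-- **Left-invariant vector fields are complete** (Lee 2012, Thm. 9.18): through every point of
`G` there is an integral curve of `mulInvariantVectorField v` defined on all of `ℝ`. A local
integral curve through `1` on `(-ε, ε)` is left-translated to every point of `G`, so `ε` is a
uniform time of existence, and Lee's uniform-time lemma (Lemma 9.15,
`exists_isMIntegralCurve_of_isMIntegralCurveOn`) applies. [cite: LeeSmoothManifolds2013, Thm. 9.18] -/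
theorem exists_isMIntegralCurve_mulInvariantVectorField (v : GroupLieAlgebra I G) (g : G) :
    ∃ γ : ℝ → G, γ 0 = g ∧ IsMIntegralCurve γ (mulInvariantVectorField v) := by
  have hV := contMDiff_mulInvariantVectorField_one (I := I) v
  obtain ⟨γ₀, h0, hγ₀⟩ :=
    exists_isMIntegralCurveAt_of_contMDiffAt_boundaryless (0 : ℝ) (hV.contMDiffAt (x := (1 : G)))
  obtain ⟨ε, hε, hγε⟩ := isMIntegralCurveAt_iff'.1 hγ₀
  rw [Real.ball_eq_Ioo, zero_sub, zero_add] at hγε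
  refine exists_isMIntegralCurve_of_isMIntegralCurveOn hV hε (fun x => ?_) g
  exact ⟨fun t => x * γ₀ t, by simp [h0], isMIntegralCurveOn_mul_left hγε x⟩

/-! ### One-parameter subgroups (Lee 2012, Thm. 20.1) -/

/-- **The one-parameter subgroup generated by `v ∈ 𝔤`**: the integral curve of the left-invariant
vector field `mulInvariantVectorField v` through the identity, defined on all of `ℝ` (chosen by
`Classical.epsilon`; it exists by `exists_isMIntegralCurve_mulInvariantVectorField` and is unique).
[cite: LeeSmoothManifolds2013, Thm. 20.1] -/
def lieExpCurve {E : Type u} [NormedAddCommGroup E] [NormedSpace ℝ E]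
    {H : Type*} [TopologicalSpace H] {I : ModelWithCorners ℝ E H}
    {G : Type*} [TopologicalSpace G] [ChartedSpace H G] [Group G]
    (v : GroupLieAlgebra I G) : ℝ → G :=
  @Classical.epsilon (ℝ → G) ⟨fun _ => 1⟩
    (fun γ => γ 0 = 1 ∧ IsMIntegralCurve γ (mulInvariantVectorField v))

/-- **The exponential map** `exp : 𝔤 → G` of a Lie group: `exp v = γ_v(1)` for the one-parameter
subgroup `γ_v` generated by `v`. [cite: LeeSmoothManifolds2013, Ch. 20, "The Exponential Map" (p. 547)] -/
def lieExp {E : Type u} [NormedAddCommGroup E] [NormedSpace ℝ E]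
    {H : Type*} [TopologicalSpace H] {I : ModelWithCorners ℝ E H}
    {G : Type*} [TopologicalSpace G] [ChartedSpace H G] [Group G]
    (v : GroupLieAlgebra I G) : G :=
  lieExpCurve v 1

/-- The defining property of `lieExpCurve v`: it starts at `1` and is a global integral curve of
`mulInvariantVectorField v`. [cite: LeeSmoothManifolds2013, Thm. 20.1] -/
private theorem lieExpCurve_spec (v : GroupLieAlgebra I G) :
    lieExpCurve v 0 = 1 ∧ IsMIntegralCurve (lieExpCurve v) (mulInvariantVectorField v) :=
  @Classical.epsilon_spec (ℝ → G) (fun γ => γ 0 = 1 ∧ IsMIntegralCurve γ (mulInvariantVectorField v))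
    (exists_isMIntegralCurve_mulInvariantVectorField v 1)

/-- The one-parameter subgroup generated by `v` starts at the identity. [cite: LeeSmoothManifolds2013, Thm. 20.1] -/
@[simp] theorem lieExpCurve_zero (v : GroupLieAlgebra I G) : lieExpCurve v 0 = 1 :=
  (lieExpCurve_spec v).1

/-- The one-parameter subgroup generated by `v` is a global integral curve of the left-invariant
vector field `mulInvariantVectorField v`. [cite: LeeSmoothManifolds2013, Thm. 20.1] -/
theorem isMIntegralCurve_lieExpCurve (v : GroupLieAlgebra I G) :
    IsMIntegralCurve (lieExpCurve v) (mulInvariantVectorField v) :=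
  (lieExpCurve_spec v).2

/-- **The flow of a left-invariant field is right multiplication by the one-parameter subgroup**
(Lee 2012, Prop. 20.8 (h)): every global integral curve `γ` of `mulInvariantVectorField v` is
`t ↦ γ 0 * lieExpCurve v t`. [cite: LeeSmoothManifolds2013, Prop. 20.8 (h)] -/
theorem eq_mul_lieExpCurve_of_isMIntegralCurve {v : GroupLieAlgebra I G} {γ : ℝ → G}
    (hγ : IsMIntegralCurve γ (mulInvariantVectorField v)) :
    γ = fun t => γ 0 * lieExpCurve v t :=
  eq_of_isMIntegralCurve_family (contMDiff_mulInvariantVectorField_one v)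
    (θ := fun x t => x * lieExpCurve v t) (fun x => by simp)
    (fun x => isMIntegralCurve_mul_left (isMIntegralCurve_lieExpCurve v) x) hγ

/-- Uniqueness of the one-parameter subgroup: a global integral curve of `mulInvariantVectorField v`
through the identity is `lieExpCurve v`. [cite: LeeSmoothManifolds2013, Thm. 20.1] -/
theorem eq_lieExpCurve_of_isMIntegralCurve {v : GroupLieAlgebra I G} {γ : ℝ → G}
    (hγ : IsMIntegralCurve γ (mulInvariantVectorField v)) (h0 : γ 0 = 1) : γ = lieExpCurve v := by
  rw [eq_mul_lieExpCurve_of_isMIntegralCurve hγ, h0]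
  ext t
  exact one_mul _

/-- An integral curve of `mulInvariantVectorField v` on an open interval about `0` agrees there with
`t ↦ γ 0 * lieExpCurve v t`. [cite: LeeSmoothManifolds2013, Thm. 9.12 (a)] -/
theorem eqOn_mul_lieExpCurve_of_isMIntegralCurveOn {v : GroupLieAlgebra I G} {γ : ℝ → G} {a b : ℝ}
    (hab : (0 : ℝ) ∈ Ioo a b) (hγ : IsMIntegralCurveOn γ (mulInvariantVectorField v) (Ioo a b)) :
    EqOn γ (fun t => γ 0 * lieExpCurve v t) (Ioo a b) :=
  eqOn_of_isMIntegralCurve_family (contMDiff_mulInvariantVectorField_one v)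
    (θ := fun x t => x * lieExpCurve v t) (fun x => by simp)
    (fun x => isMIntegralCurve_mul_left (isMIntegralCurve_lieExpCurve v) x) hab hγ

/-- **One-parameter subgroups are homomorphisms** (Lee 2012, Thm. 20.1):
`γ_v(s + t) = γ_v(s) γ_v(t)`. [cite: LeeSmoothManifolds2013, Thm. 20.1] -/
theorem lieExpCurve_add (v : GroupLieAlgebra I G) (s t : ℝ) :
    lieExpCurve v (s + t) = lieExpCurve v s * lieExpCurve v t := by
  have h := isMIntegralCurve_family_add (contMDiff_mulInvariantVectorField_one v)
    (θ := fun x t => x * lieExpCurve v t) (fun x => by simp)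
    (fun x => isMIntegralCurve_mul_left (isMIntegralCurve_lieExpCurve v) x) 1 s t
  simpa only [one_mul] using h

/-- `γ_v(-t) = γ_v(t)⁻¹`. [cite: LeeSmoothManifolds2013, Prop. 20.8 (c)] -/
theorem lieExpCurve_neg (v : GroupLieAlgebra I G) (t : ℝ) :
    lieExpCurve v (-t) = (lieExpCurve v t)⁻¹ := by
  apply eq_inv_of_mul_eq_one_left
  rw [← lieExpCurve_add, neg_add_cancel, lieExpCurve_zero]

/-- The values of a one-parameter subgroup commute with each other. [cite: LeeSmoothManifolds2013, Thm. 20.1] -/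
theorem lieExpCurve_mul_comm (v : GroupLieAlgebra I G) (s t : ℝ) :
    lieExpCurve v s * lieExpCurve v t = lieExpCurve v t * lieExpCurve v s := by
  rw [← lieExpCurve_add, ← lieExpCurve_add, add_comm]

/-- **Rescaling** (Lee 2012, Lemma 9.3 / proof of Prop. 20.5): the one-parameter subgroup
generated by `c • v` is `t ↦ γ_v(c t)`. [cite: LeeSmoothManifolds2013, Prop. 20.5 (proof)] -/
theorem lieExpCurve_smul (c : ℝ) (v : GroupLieAlgebra I G) (t : ℝ) :
    lieExpCurve (c • v) t = lieExpCurve v (c * t) := by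
  have h1 : IsMIntegralCurve (fun t => lieExpCurve v (t * c)) (c • mulInvariantVectorField v) :=
    (isMIntegralCurve_lieExpCurve v).comp_mul c
  rw [← mulInvariantVectorField_smul] at h1
  have h2 := eq_lieExpCurve_of_isMIntegralCurve h1 (by simp)
  have h3 : lieExpCurve v (t * c) = lieExpCurve (c • v) t := congrFun h2 t
  rw [← h3, mul_comm]

/-- The one-parameter subgroup generated by `0` is constant. [cite: LeeSmoothManifolds2013, Thm. 20.1] -/
@[simp] theorem lieExpCurve_zero_left (t : ℝ) : lieExpCurve (0 : GroupLieAlgebra I G) t = 1 := by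
  have h : IsMIntegralCurve (fun _ : ℝ => (1 : G)) (mulInvariantVectorField (0 : GroupLieAlgebra I G)) := by
    apply isMIntegralCurve_const
    have h0 : mulInvariantVectorField (0 : GroupLieAlgebra I G) = 0 := by
      simpa using mulInvariantVectorField_smul (I := I) (G := G) (0 : ℝ) 0
    rw [h0]
    rfl
  have h2 := eq_lieExpCurve_of_isMIntegralCurve h rfl
  exact (congrFun h2 t).symm

/-! ### The exponential map (Lee 2012, Prop. 20.5, Prop. 20.8) -/

/-- `exp 0 = 1`. [cite: LeeSmoothManifolds2013, Prop. 20.8] -/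
@[simp] theorem lieExp_zero : lieExp (0 : GroupLieAlgebra I G) = 1 :=
  lieExpCurve_zero_left 1

/-- **Lee 2012, Prop. 20.5**: `t ↦ exp (t • v)` is the one-parameter subgroup generated by `v`.
[cite: LeeSmoothManifolds2013, Prop. 20.5] -/
theorem lieExpCurve_eq_lieExp_smul (v : GroupLieAlgebra I G) (t : ℝ) :
    lieExpCurve v t = lieExp (t • v) := by
  rw [lieExp, lieExpCurve_smul, mul_one]

/-- `exp ((s + t) • v) = exp (s • v) * exp (t • v)`. [cite: LeeSmoothManifolds2013, Prop. 20.8 (b)] -/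
theorem lieExp_add_smul (v : GroupLieAlgebra I G) (s t : ℝ) :
    lieExp ((s + t) • v) = lieExp (s • v) * lieExp (t • v) := by
  simp only [← lieExpCurve_eq_lieExp_smul, lieExpCurve_add]

/-- `exp (s • v)` and `exp (t • v)` commute. [cite: LeeSmoothManifolds2013, Prop. 20.8 (b)] -/
theorem lieExp_smul_mul_comm (v : GroupLieAlgebra I G) (s t : ℝ) :
    lieExp (s • v) * lieExp (t • v) = lieExp (t • v) * lieExp (s • v) := by
  simp only [← lieExpCurve_eq_lieExp_smul, lieExpCurve_mul_comm]

/-- `exp (-v) = (exp v)⁻¹`. [cite: LeeSmoothManifolds2013, Prop. 20.8 (c)] -/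
theorem lieExp_neg (v : GroupLieAlgebra I G) : lieExp (-v) = (lieExp v)⁻¹ := by
  have h := lieExpCurve_neg v 1
  rw [lieExpCurve_eq_lieExp_smul, lieExpCurve_eq_lieExp_smul, neg_smul, one_smul] at h
  exact h

/-- `exp (n • v) = (exp v) ^ n` for `n : ℕ`. [cite: LeeSmoothManifolds2013, Prop. 20.8 (d)] -/
theorem lieExp_natCast_smul (v : GroupLieAlgebra I G) (n : ℕ) :
    lieExp ((n : ℝ) • v) = (lieExp v) ^ n := by
  induction n with
  | zero => simp
  | succ n ih =>
    rw [Nat.cast_succ, lieExp_add_smul, ih, one_smul, pow_succ]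

/-- `exp (n • v) = (exp v) ^ n` for `n : ℤ`. [cite: LeeSmoothManifolds2013, Prop. 20.8 (d)] -/
theorem lieExp_intCast_smul (v : GroupLieAlgebra I G) (n : ℤ) :
    lieExp ((n : ℝ) • v) = (lieExp v) ^ n := by
  obtain ⟨m, rfl | rfl⟩ := Int.eq_nat_or_neg n
  · simpa using lieExp_natCast_smul v m
  · rw [Int.cast_neg, Int.cast_natCast, neg_smul, lieExp_neg, lieExp_natCast_smul, zpow_neg,
      zpow_natCast]

/-! ### Derivatives and smoothness -/

/-- The one-parameter subgroup `γ_v` has velocity `X_v(γ_v t)` at time `t`. [cite: LeeSmoothManifolds2013, Thm. 20.1] -/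
theorem hasMFDerivAt_lieExpCurve (v : GroupLieAlgebra I G) (t : ℝ) :
    HasMFDerivAt 𝓘(ℝ, ℝ) I (lieExpCurve v) t
      ((1 : ℝ →L[ℝ] ℝ).smulRight (mulInvariantVectorField v (lieExpCurve v t))) :=
  isMIntegralCurve_lieExpCurve v t

/-- **Initial velocity**: `γ_v'(0) = v`, i.e. `(d/dt)|_{t=0} exp (t • v) = v`
(Lee 2012, Prop. 20.8 (e), the computation). [cite: LeeSmoothManifolds2013, Prop. 20.8 (e)] -/
theorem hasMFDerivAt_lieExpCurve_zero (v : GroupLieAlgebra I G) :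
    HasMFDerivAt 𝓘(ℝ, ℝ) I (lieExpCurve v) 0 ((1 : ℝ →L[ℝ] ℝ).smulRight v) := by
  have h := hasMFDerivAt_lieExpCurve v 0
  rwa [lieExpCurve_zero, mulInvariantVectorField_one] at h

/-- **Joint smoothness of the flow** `(g, t) ↦ g * exp (t • v)` of a left-invariant vector field
(Lee 2012, Thm. 9.12 for the complete field `X_v`, via the tree's
`contMDiff_of_isMIntegralCurve_family`). [cite: LeeSmoothManifolds2013, Prop. 20.8 (h)] -/
theorem contMDiff_mul_lieExpCurve (v : GroupLieAlgebra I G) :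
    ContMDiff (I.prod 𝓘(ℝ, ℝ)) I ∞ (fun p : G × ℝ => p.1 * lieExpCurve v p.2) :=
  contMDiff_of_isMIntegralCurve_family (n := (⊤ : ℕ∞)) (contMDiff_mulInvariantVectorField_infty v)
    le_top (θ := fun x t => x * lieExpCurve v t) (fun x => by simp)
    (fun x => isMIntegralCurve_mul_left (isMIntegralCurve_lieExpCurve v) x)

/-- The one-parameter subgroup `t ↦ exp (t • v)` is a `C^∞` curve. [cite: LeeSmoothManifolds2013, Prop. 20.8 (a)] -/
theorem contMDiff_lieExpCurve (v : GroupLieAlgebra I G) :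
    ContMDiff 𝓘(ℝ, ℝ) I ∞ (lieExpCurve v) := by
  have h := (contMDiff_mul_lieExpCurve v).comp
    ((contMDiff_const (c := (1 : G))).prodMk contMDiff_id)
  simpa only [comp_def, one_mul, id_eq] using h

/-- The one-parameter subgroup `t ↦ exp (t • v)` is continuous. [cite: LeeSmoothManifolds2013, Prop. 20.8 (a)] -/
theorem continuous_lieExpCurve (v : GroupLieAlgebra I G) : Continuous (lieExpCurve v) :=
  (isMIntegralCurve_lieExpCurve v).continuous

/-! ### Smooth dependence on the generator (Lee 2012, Prop. 20.8 (a)) -/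

omit [CompleteSpace E] [T2Space G] [BoundarylessManifold I G] in
set_option backward.defeqAttrib.useBackward true in
/-- The left-invariant vector fields depend smoothly on the generator: `(g, v) ↦ X_v(g) ∈ TG` is
`C^∞` on `G × 𝔤` (the derivative of multiplication applied to the smooth section
`(g, v) ↦ ((g, 0), (1, v))` of `T(G × G)`; Lee 2012, proof of Prop. 20.8 (a), smoothness of `Ξ`).
[cite: LeeSmoothManifolds2013, Prop. 20.8 (a) (proof)] -/
theorem contMDiff_mulInvariantVectorField_prod :
    ContMDiff (I.prod 𝓘(ℝ, E)) I.tangent ∞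
      (fun p : G × E =>
        (mulInvariantVectorField (I := I) (G := G) p.2 p.1 : TangentBundle I G)) := by
  let fg : G × E → TangentBundle I G := fun p => Bundle.TotalSpace.mk' E p.1 0
  have sfg : ContMDiff (I.prod 𝓘(ℝ, E)) I.tangent ∞ fg :=
    (Bundle.contMDiff_zeroSection ℝ (TangentSpace I : G → Type _)).comp
      (contMDiff_fst : ContMDiff (I.prod 𝓘(ℝ, E)) I ∞ (Prod.fst : G × E → G))
  let fv : G × E → TangentBundle I G := fun p => Bundle.TotalSpace.mk' E (1 : G) p.2
  have sfv : ContMDiff (I.prod 𝓘(ℝ, E)) I.tangent ∞ fv :=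
    (contMDiff_tangentBundle_mk (I := I) (1 : G)).comp
      (contMDiff_snd : ContMDiff (I.prod 𝓘(ℝ, E)) 𝓘(ℝ, E) ∞ (Prod.snd : G × E → E))
  let F₁ : G × E → TangentBundle I G × TangentBundle I G := fun p => (fg p, fv p)
  have S₁ : ContMDiff (I.prod 𝓘(ℝ, E)) (I.tangent.prod I.tangent) ∞ F₁ := sfg.prodMk sfv
  let F₂ : TangentBundle I G × TangentBundle I G → TangentBundle (I.prod I) (G × G) :=
    (equivTangentBundleProd I G I G).symm
  have S₂ : ContMDiff (I.tangent.prod I.tangent) (I.prod I).tangent ∞ F₂ :=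
    contMDiff_equivTangentBundleProd_symm
  let F₃ : TangentBundle (I.prod I) (G × G) → TangentBundle I G :=
    tangentMap (I.prod I) I (fun p : G × G => p.1 * p.2)
  have S₃ : ContMDiff (I.prod I).tangent I.tangent ∞ F₃ :=
    ContMDiff.contMDiff_tangentMap (contMDiff_mul I ∞) (m := ∞) (by exact le_of_eq (by simp))
  have S := (S₃.comp S₂).comp S₁
  convert! S with p
  · simp [F₁, F₂, F₃, fg, fv]
  · simp only [comp_apply, tangentMap, F₃, F₂, F₁, fg, fv]
    rw [mfderiv_prod_eq_add_apply ((contMDiff_mul I ∞).mdifferentiableAt (by simp))]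
    simp +instances [mulInvariantVectorField]

omit [CompleteSpace E] [T2Space G] [BoundarylessManifold I G] in
/-- Lee's auxiliary vector field `Ξ(g, v) = (X_v(g), 0)` on `G × 𝔤` is a `C^∞` section of
`T(G × 𝔤)`. [cite: LeeSmoothManifolds2013, Prop. 20.8 (a) (proof)] -/
theorem contMDiff_expField :
    ContMDiff (I.prod 𝓘(ℝ, E)) (I.prod 𝓘(ℝ, E)).tangent ∞
      (fun p : G × E => (⟨p, ((mulInvariantVectorField (I := I) (G := G) p.2 p.1, (0 : E)) :
        TangentSpace (I.prod 𝓘(ℝ, E)) p)⟩ : TangentBundle (I.prod 𝓘(ℝ, E)) (G × E))) := by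
  have h1 := contMDiff_mulInvariantVectorField_prod (I := I) (G := G)
  have h2 : ContMDiff (I.prod 𝓘(ℝ, E)) (𝓘(ℝ, E)).tangent ∞
      (fun p : G × E => (Bundle.TotalSpace.mk' E p.2 (0 : E) : TangentBundle 𝓘(ℝ, E) E)) :=
    (Bundle.contMDiff_zeroSection ℝ (TangentSpace 𝓘(ℝ, E) : E → Type _)).comp
      (contMDiff_snd : ContMDiff (I.prod 𝓘(ℝ, E)) 𝓘(ℝ, E) ∞ (Prod.snd : G × E → E))
  exact (contMDiff_equivTangentBundleProd_symm (n := ∞)).comp (h1.prodMk h2)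

/-- The flow of `Ξ`: `t ↦ (g * exp (t • v), v)` is a global integral curve of `Ξ` through
`(g, v)`. [cite: LeeSmoothManifolds2013, Prop. 20.8 (a) (proof)] -/
theorem isMIntegralCurve_expField (p : G × E) :
    IsMIntegralCurve (I := I.prod 𝓘(ℝ, E)) (fun t => (p.1 * lieExpCurve (I := I) (G := G) p.2 t, p.2))
      (fun q : G × E => ((mulInvariantVectorField (I := I) (G := G) q.2 q.1, (0 : E)) :
        TangentSpace (I.prod 𝓘(ℝ, E)) q)) := by
  intro t
  have h1 := isMIntegralCurve_mul_left
    (isMIntegralCurve_lieExpCurve (I := I) (G := G) (p.2 : GroupLieAlgebra I G)) p.1 t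
  have h2 : HasMFDerivAt 𝓘(ℝ, ℝ) 𝓘(ℝ, E) (fun _ : ℝ => p.2) t
      (0 : TangentSpace 𝓘(ℝ, ℝ) t →L[ℝ] TangentSpace 𝓘(ℝ, E) p.2) :=
    hasMFDerivAt_const p.2 t
  have he : ((1 : ℝ →L[ℝ] ℝ).smulRight (mulInvariantVectorField (I := I) (G := G) p.2
        (p.1 * lieExpCurve (I := I) (G := G) p.2 t))).prod (0 : ℝ →L[ℝ] E) =
      (1 : ℝ →L[ℝ] ℝ).smulRight ((mulInvariantVectorField (I := I) (G := G) p.2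
        (p.1 * lieExpCurve (I := I) (G := G) p.2 t), (0 : E)) : E × E) := by
    apply ContinuousLinearMap.ext_ring
    show ((((1 : ℝ →L[ℝ] ℝ) (1 : ℝ)) • mulInvariantVectorField (I := I) (G := G) p.2
        (p.1 * lieExpCurve (I := I) (G := G) p.2 t), (0 : ℝ →L[ℝ] E) (1 : ℝ)) : E × E) =
      ((1 : ℝ →L[ℝ] ℝ) (1 : ℝ)) • ((mulInvariantVectorField (I := I) (G := G) p.2
        (p.1 * lieExpCurve (I := I) (G := G) p.2 t), (0 : E)) : E × E)
    simp only [one_apply_eq_self, one_smul, zero_apply]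
  exact (h1.prodMk h2).congr_mfderiv he

/-- **The exponential map is jointly smooth in the generator and the time**:
`(v, t) ↦ exp (t • v) = lieExpCurve v t` is `C^∞` on `𝔤 × ℝ` (Lee 2012, Prop. 20.8 (a): the flow
of `Ξ` on `G × 𝔤` is `Θ_t(g, v) = (g exp(tv), v)`, smooth by the fundamental theorem on flows,
here `contMDiff_of_isMIntegralCurve_family` for the complete field `Ξ`). [cite: LeeSmoothManifolds2013, Prop. 20.8 (a)] -/
theorem contMDiff_lieExpCurve_uncurry :
    ContMDiff (𝓘(ℝ, E).prod 𝓘(ℝ, ℝ)) I ∞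
      (fun q : E × ℝ => lieExpCurve (I := I) (G := G) q.1 q.2) := by
  have hflow := contMDiff_of_isMIntegralCurve_family (I := I.prod 𝓘(ℝ, E)) (M := G × E)
    (n := (⊤ : ℕ∞)) (contMDiff_expField (I := I) (G := G)) le_top
    (θ := fun p t => (p.1 * lieExpCurve (I := I) (G := G) p.2 t, p.2)) (fun p => by simp)
    (fun p => isMIntegralCurve_expField p)
  have hi : ContMDiff (𝓘(ℝ, E).prod 𝓘(ℝ, ℝ)) ((I.prod 𝓘(ℝ, E)).prod 𝓘(ℝ, ℝ)) ∞
      (fun q : E × ℝ => (((1 : G), q.1), q.2)) :=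
    (contMDiff_const.prodMk contMDiff_fst).prodMk contMDiff_snd
  have h := (contMDiff_fst.comp hflow).comp hi
  simpa only [comp_def, one_mul] using h

/-- **The exponential map is smooth** (Lee 2012, Prop. 20.8 (a)): `exp : 𝔤 → G` is `C^∞`
(`𝔤 = T_1 G` carried by the model vector space `E`). [cite: LeeSmoothManifolds2013, Prop. 20.8 (a)] -/
theorem contMDiff_lieExp :
    ContMDiff 𝓘(ℝ, E) I ∞ (fun v : E => lieExp (I := I) (G := G) v) :=
  contMDiff_lieExpCurve_uncurry.comp (contMDiff_id.prodMk contMDiff_const)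

/-- The exponential map is continuous. [cite: LeeSmoothManifolds2013, Prop. 20.8 (a)] -/
theorem continuous_lieExp : Continuous (fun v : E => lieExp (I := I) (G := G) v) :=
  contMDiff_lieExp.continuous

/-! ### The differential at `0` and canonical coordinates (Lee 2012, Prop. 20.8 (e), (f)) -/

/-- **`(d exp)_0 = id`**, applied form: `(d exp)_0 w = w` (Lee 2012, Prop. 20.8 (e): differentiate
`t ↦ exp (t • w)` at `t = 0`). [cite: LeeSmoothManifolds2013, Prop. 20.8 (e)] -/
theorem mfderiv_lieExp_zero_apply (w : E) :
    mfderiv 𝓘(ℝ, E) I (fun v : E => lieExp (I := I) (G := G) v) 0 w = w := by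
  have hd : MDifferentiableAt 𝓘(ℝ, E) I (fun v : E => lieExp (I := I) (G := G) v) 0 :=
    contMDiff_lieExp.mdifferentiableAt (by simp)
  have hc' : HasDerivAt (fun t : ℝ => t • w) ((1 : ℝ) • w) 0 := (hasDerivAt_id (0 : ℝ)).smul_const w
  rw [one_smul] at hc'
  have hc : HasMFDerivAt 𝓘(ℝ, ℝ) 𝓘(ℝ, E) (fun t : ℝ => t • w) 0 ((1 : ℝ →L[ℝ] ℝ).smulRight w) :=
    hasMFDerivAt_iff_hasFDerivAt.2 hc'.hasFDerivAt
  have hcomp : (fun v : E => lieExp (I := I) (G := G) v) ∘ (fun t : ℝ => t • w) =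
      lieExpCurve (I := I) (G := G) w := by
    funext t
    exact (lieExpCurve_eq_lieExp_smul (I := I) (G := G) w t).symm
  have h1 : mfderiv 𝓘(ℝ, ℝ) I ((fun v : E => lieExp (I := I) (G := G) v) ∘ (fun t : ℝ => t • w))
      0 (1 : ℝ) = w := by
    rw [hcomp, (hasMFDerivAt_lieExpCurve_zero (I := I) (G := G) w).mfderiv]
    show ((1 : ℝ →L[ℝ] ℝ) (1 : ℝ)) • w = w
    rw [one_apply_eq_self, one_smul]
  rw [mfderiv_comp_apply_of_eq (0 : ℝ) hd hc.mdifferentiableAt (zero_smul ℝ w), hc.mfderiv] at h1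
  have e : ((1 : ℝ →L[ℝ] ℝ).smulRight w) (1 : ℝ) = w := by
    show ((1 : ℝ →L[ℝ] ℝ) (1 : ℝ)) • w = w
    rw [one_apply_eq_self, one_smul]
  exact (congrArg (mfderiv 𝓘(ℝ, E) I (fun v : E => lieExp (I := I) (G := G) v) 0) e).symm.trans h1

/-- **`(d exp)_0 = id`** (Lee 2012, Prop. 20.8 (e)). [cite: LeeSmoothManifolds2013, Prop. 20.8 (e)] -/
theorem mfderiv_lieExp_zero :
    mfderiv 𝓘(ℝ, E) I (fun v : E => lieExp (I := I) (G := G) v) 0 = ContinuousLinearMap.id ℝ E :=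
  ContinuousLinearMap.ext (mfderiv_lieExp_zero_apply (I := I) (G := G))

/-- `exp` has differential the identity at `0`. [cite: LeeSmoothManifolds2013, Prop. 20.8 (e)] -/
theorem hasMFDerivAt_lieExp_zero :
    HasMFDerivAt 𝓘(ℝ, E) I (fun v : E => lieExp (I := I) (G := G) v) 0
      (ContinuousLinearMap.id ℝ E) :=
  ((contMDiff_lieExp (I := I) (G := G)).mdifferentiableAt (by simp)).hasMFDerivAt.congr_mfderiv
    mfderiv_lieExp_zero

end LieExp

section CanonicalCoordinates

variable {E : Type u} [NormedAddCommGroup E] [NormedSpace ℝ E] [CompleteSpace E]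
  {H : Type*} [TopologicalSpace H] {I : ModelWithCorners ℝ E H} [I.Boundaryless]
  {G : Type*} [TopologicalSpace G] [ChartedSpace H G] [Group G] [LieGroup I ∞ G] [T2Space G]

/-- **Canonical coordinates of the first kind** (Lee 2012, Prop. 20.8 (f)): `exp` is a `C^∞`
local diffeomorphism at `0` (inverse function theorem on manifolds,
`Literature.Geometry.Manifold.isLocalDiffeomorphAt_of_mfderiv`, applied to `(d exp)_0 = id`).
[cite: LeeSmoothManifolds2013, Prop. 20.8 (f)] -/
theorem isLocalDiffeomorphAt_lieExp :
    IsLocalDiffeomorphAt 𝓘(ℝ, E) I ∞ (fun v : E => lieExp (I := I) (G := G) v) 0 :=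
  isLocalDiffeomorphAt_of_mfderiv (by simp) isOpen_univ (mem_univ _)
    (contMDiff_lieExp (I := I) (G := G)).contMDiffOn (ContinuousLinearEquiv.refl ℝ E)
    (by rw [mfderiv_lieExp_zero]; rfl)

/-- **`exp` is onto a neighbourhood of the identity**: `range exp ∈ 𝓝 1`
(from Prop. 20.8 (f)). [cite: LeeSmoothManifolds2013, Prop. 20.8 (f)] -/
theorem range_lieExp_mem_nhds_one :
    range (fun v : E => lieExp (I := I) (G := G) v) ∈ 𝓝 (1 : G) := by
  obtain ⟨Φ, h0, hΦ⟩ := isLocalDiffeomorphAt_lieExp (I := I) (G := G)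
  have h1 : Φ 0 = (1 : G) := by
    rw [← hΦ h0]
    exact lieExp_zero
  have ht : Φ.target ∈ 𝓝 (1 : G) := by
    rw [← h1]
    exact Φ.open_target.mem_nhds (Φ.map_source h0)
  refine mem_of_superset ht fun y hy => ?_
  exact ⟨Φ.symm y, (hΦ (Φ.map_target hy)).trans (Φ.right_inv hy)⟩

/-- **`exp` generates a connected Lie group**: the subgroup generated by `exp(𝔤)` is all of `G`
(it contains a neighbourhood of `1`, hence is open, hence closed, hence everything).
[cite: LeeSmoothManifolds2013, Prop. 7.14 and Prop. 20.8 (f)] -/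
theorem subgroupClosure_range_lieExp [ConnectedSpace G] :
    Subgroup.closure (range (fun v : E => lieExp (I := I) (G := G) v)) = ⊤ := by
  have hG : IsTopologicalGroup G := topologicalGroup_of_lieGroup I ∞
  set K := Subgroup.closure (range (fun v : E => lieExp (I := I) (G := G) v)) with hK
  have hmem : (K : Set G) ∈ 𝓝 (1 : G) :=
    mem_of_superset (range_lieExp_mem_nhds_one (I := I) (G := G)) Subgroup.subset_closure
  have hopen : IsOpen (K : Set G) := Subgroup.isOpen_of_mem_nhds K hmem
  have hclosed : IsClosed (K : Set G) := Subgroup.isClosed_of_isOpen K hopen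
  have huniv : (K : Set G) = univ := IsClopen.eq_univ ⟨hclosed, hopen⟩ ⟨1, K.one_mem⟩
  exact (Subgroup.coe_eq_univ).1 huniv

end CanonicalCoordinates

section Commutative

variable {E : Type u} [NormedAddCommGroup E] [NormedSpace ℝ E] [CompleteSpace E]
  {H : Type*} [TopologicalSpace H] {I : ModelWithCorners ℝ E H}
  {G : Type*} [TopologicalSpace G] [ChartedSpace H G] [CommGroup G] [LieGroup I ∞ G]
  [T2Space G] [BoundarylessManifold I G]

omit [CompleteSpace E] [T2Space G] [BoundarylessManifold I G] in
/-- In a **commutative** Lie group the differential of multiplication adds left-invariant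
vectors: `d(mul)_{(a,b)}(X_v(a), X_w(b)) = X_{v+w}(ab)` (`R_b = L_b`). [cite: LeeSmoothManifolds2013, Problem 20-8] -/
theorem mfderiv_mul_mulInvariantVectorField (v w : GroupLieAlgebra I G) (a b : G) :
    mfderiv (I.prod I) I (fun q : G × G => q.1 * q.2) (a, b)
        ((mulInvariantVectorField v a, mulInvariantVectorField w b) : E × E) =
      mulInvariantVectorField (v + w) (a * b) := by
  have hm : MDifferentiableAt (I.prod I) I (fun q : G × G => q.1 * q.2) (a, b) :=
    (contMDiff_mul I ∞).mdifferentiableAt (by simp)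
  rw [mfderiv_prod_eq_add_apply hm, mulInvariantVectorField_add]
  have h1 : (mfderiv I I (fun z : G => z * b) a (mulInvariantVectorField v a) : E) =
      mulInvariantVectorField v (a * b) := by
    have hfun : (fun z : G => b * z) = (fun z : G => z * b) := funext fun z => mul_comm b z
    have h2 : (mfderiv I I (fun z : G => b * z) a (mulInvariantVectorField v a) : E) =
        mulInvariantVectorField v (a * b) := by
      have h3 := mfderiv_mul_left_mulInvariantVectorField (I := I) v b a
      rw [mul_comm b a] at h3
      exact h3
    exact hfun ▸ h2
  show (mfderiv I I (fun z : G => z * b) a (mulInvariantVectorField v a) : E) +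
      mfderiv I I (fun z : G => a * z) b (mulInvariantVectorField w b) =
    mulInvariantVectorField v (a * b) + mulInvariantVectorField w (a * b)
  rw [h1, mfderiv_mul_left_mulInvariantVectorField w a b]

/-- In a **commutative** Lie group the product of two one-parameter subgroups is the one-parameter
subgroup of the sum of the generators: `γ_{v+w}(t) = γ_v(t) γ_w(t)` (the product is an integral
curve of `X_{v+w}` by `mfderiv_mul_mulInvariantVectorField`).
[cite: LeeSmoothManifolds2013, Problem 20-8] -/
theorem lieExpCurve_add_left (v w : GroupLieAlgebra I G) (t : ℝ) :
    lieExpCurve (v + w) t = lieExpCurve v t * lieExpCurve w t := by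
  have key : IsMIntegralCurve (fun t => lieExpCurve v t * lieExpCurve w t)
      (mulInvariantVectorField (v + w)) := by
    intro t
    have hm : MDifferentiableAt (I.prod I) I (fun q : G × G => q.1 * q.2)
        (lieExpCurve v t, lieExpCurve w t) :=
      (contMDiff_mul I ∞).mdifferentiableAt (by simp)
    have hprod := (hasMFDerivAt_lieExpCurve v t).prodMk (hasMFDerivAt_lieExpCurve w t)
    have hcomp := hm.hasMFDerivAt.comp t hprod
    have he : (mfderiv (I.prod I) I (fun q : G × G => q.1 * q.2)
          (lieExpCurve v t, lieExpCurve w t)).comp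
        (((1 : ℝ →L[ℝ] ℝ).smulRight (mulInvariantVectorField v (lieExpCurve v t))).prod
          ((1 : ℝ →L[ℝ] ℝ).smulRight (mulInvariantVectorField w (lieExpCurve w t)))) =
        (1 : ℝ →L[ℝ] ℝ).smulRight
          (mulInvariantVectorField (v + w) (lieExpCurve v t * lieExpCurve w t)) := by
      apply ContinuousLinearMap.ext_ring
      show mfderiv (I.prod I) I (fun q : G × G => q.1 * q.2) (lieExpCurve v t, lieExpCurve w t)
          ((((1 : ℝ →L[ℝ] ℝ) (1 : ℝ)) • mulInvariantVectorField v (lieExpCurve v t),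
            ((1 : ℝ →L[ℝ] ℝ) (1 : ℝ)) • mulInvariantVectorField w (lieExpCurve w t)) : E × E) =
        ((1 : ℝ →L[ℝ] ℝ) (1 : ℝ)) •
          mulInvariantVectorField (v + w) (lieExpCurve v t * lieExpCurve w t)
      simp only [one_apply_eq_self, one_smul]
      exact mfderiv_mul_mulInvariantVectorField v w _ _
    exact hcomp.congr_mfderiv he
  have h := eq_lieExpCurve_of_isMIntegralCurve key (by simp)
  exact (congrFun h t).symm

/-- **`exp (v + w) = exp v * exp w` in a commutative Lie group** (Lee 2012, Problem 20-8; false in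
general). [cite: LeeSmoothManifolds2013, Problem 20-8] -/
theorem lieExp_add (v w : GroupLieAlgebra I G) : lieExp (v + w) = lieExp v * lieExp w :=
  lieExpCurve_add_left v w 1

/-- In a commutative Lie group `exp : (𝔤, +) → G` is a group homomorphism.
[cite: LeeSmoothManifolds2013, Problem 20-8] -/
theorem lieExp_sub (v w : GroupLieAlgebra I G) : lieExp (v - w) = lieExp v * (lieExp w)⁻¹ := by
  rw [sub_eq_add_neg, lieExp_add, lieExp_neg]

end Commutative

section Naturality

variable {E : Type u} [NormedAddCommGroup E] [NormedSpace ℝ E] [CompleteSpace E]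
  {H : Type*} [TopologicalSpace H] {I : ModelWithCorners ℝ E H}
  {G : Type*} [TopologicalSpace G] [ChartedSpace H G] [Group G] [LieGroup I ∞ G]
  [T2Space G] [BoundarylessManifold I G]
  {E' : Type u} [NormedAddCommGroup E'] [NormedSpace ℝ E'] [CompleteSpace E']
  {H' : Type*} [TopologicalSpace H'] {I' : ModelWithCorners ℝ E' H'}
  {G' : Type*} [TopologicalSpace G'] [ChartedSpace H' G'] [Group G'] [LieGroup I' ∞ G']
  [T2Space G'] [BoundarylessManifold I' G']

omit [CompleteSpace E] [T2Space G] [BoundarylessManifold I G] [CompleteSpace E'] [T2Space G']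
  [BoundarylessManifold I' G'] in
/-- A differentiable group homomorphism `Φ` intertwines the left-invariant fields:
`dΦ_g (X_v(g)) = X_{dΦ_1 v}(Φ g)` (`Φ ∘ L_g = L_{Φ g} ∘ Φ`; Lee 2012, Thm. 8.44, `Φ`-related
left-invariant fields). [cite: LeeSmoothManifolds2013, Thm. 8.44] -/
theorem mfderiv_monoidHom_mulInvariantVectorField (Φ : G →* G') (hΦ : MDifferentiable I I' Φ)
    (v : GroupLieAlgebra I G) (g : G) :
    mfderiv I I' Φ g (mulInvariantVectorField v g) =
      mulInvariantVectorField (I := I') (G := G') (mfderiv I I' Φ (1 : G) v) (Φ g) := by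
  have h1 := mfderiv_comp_apply_of_eq (I := I) (I' := I) (I'' := I') (1 : G) (g := ⇑Φ)
    (f := fun x : G => g * x) (hΦ g) mdifferentiableAt_mul_left (mul_one g) v
  have hfun : (⇑Φ ∘ fun x : G => g * x) = (fun y : G' => Φ g * y) ∘ ⇑Φ := by
    funext x
    simp only [comp_apply, map_mul]
  have h2 := mfderiv_comp_apply_of_eq (I := I) (I' := I') (I'' := I') (1 : G)
    (g := fun y : G' => Φ g * y) (f := ⇑Φ) mdifferentiableAt_mul_left (hΦ 1) (map_one Φ) v
  rw [hfun] at h1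
  exact h1.symm.trans h2

/-- **Naturality of one-parameter subgroups** (Lee 2012, Prop. 20.8 (g), proof): a differentiable
group homomorphism maps the one-parameter subgroup generated by `v` to the one generated by
`dΦ_1 v`: `Φ (exp (t • v)) = exp (t • dΦ_1 v)`. [cite: LeeSmoothManifolds2013, Prop. 20.8 (g)] -/
theorem map_lieExpCurve (Φ : G →* G') (hΦ : MDifferentiable I I' Φ) (v : GroupLieAlgebra I G)
    (t : ℝ) :
    Φ (lieExpCurve v t) = lieExpCurve (I := I') (G := G') (mfderiv I I' Φ (1 : G) v) t := by
  have key : IsMIntegralCurve (fun t => Φ (lieExpCurve v t))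
      (mulInvariantVectorField (I := I') (G := G') (mfderiv I I' Φ (1 : G) v)) := by
    intro t
    have h := (hΦ (lieExpCurve v t)).hasMFDerivAt.comp t (hasMFDerivAt_lieExpCurve v t)
    have he : (mfderiv I I' Φ (lieExpCurve v t)).comp
        ((1 : ℝ →L[ℝ] ℝ).smulRight (mulInvariantVectorField v (lieExpCurve v t))) =
        (1 : ℝ →L[ℝ] ℝ).smulRight
          (mulInvariantVectorField (I := I') (G := G') (mfderiv I I' Φ (1 : G) v)
            (Φ (lieExpCurve v t))) := by
      apply ContinuousLinearMap.ext_ring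
      show mfderiv I I' Φ (lieExpCurve v t)
          (((1 : ℝ →L[ℝ] ℝ) (1 : ℝ)) • mulInvariantVectorField v (lieExpCurve v t)) =
        ((1 : ℝ →L[ℝ] ℝ) (1 : ℝ)) •
          mulInvariantVectorField (I := I') (G := G') (mfderiv I I' Φ (1 : G) v)
            (Φ (lieExpCurve v t))
      simp only [one_apply_eq_self, one_smul]
      exact mfderiv_monoidHom_mulInvariantVectorField Φ hΦ v _
    exact h.congr_mfderiv he
  have h := eq_lieExpCurve_of_isMIntegralCurve key (by simp)
  exact congrFun h t

/-- **Naturality of the exponential map** (Lee 2012, Prop. 20.8 (g)): for a differentiable group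
homomorphism `Φ : G → G'`, `Φ (exp v) = exp (dΦ_1 v)`. [cite: LeeSmoothManifolds2013, Prop. 20.8 (g)] -/
theorem map_lieExp (Φ : G →* G') (hΦ : MDifferentiable I I' Φ) (v : GroupLieAlgebra I G) :
    Φ (lieExp v) = lieExp (I := I') (G := G') (mfderiv I I' Φ (1 : G) v) :=
  map_lieExpCurve Φ hΦ v 1

end Naturality

section ConnectedCommutative

variable {E : Type u} [NormedAddCommGroup E] [NormedSpace ℝ E] [CompleteSpace E]
  {H : Type*} [TopologicalSpace H] {I : ModelWithCorners ℝ E H} [I.Boundaryless]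
  {G : Type*} [TopologicalSpace G] [ChartedSpace H G]

/-- **`exp` is injective near `0`** (any Lie group): there is a neighbourhood of `0 ∈ 𝔤` on which
`exp` is injective (Lee 2012, Prop. 20.8 (f)). [cite: LeeSmoothManifolds2013, Prop. 20.8 (f)] -/
theorem exists_nhds_injOn_lieExp [Group G] [LieGroup I ∞ G] [T2Space G] :
    ∃ U ∈ 𝓝 (0 : E), Set.InjOn (fun v : E => lieExp (I := I) (G := G) v) U := by
  obtain ⟨Φ, h0, hΦ⟩ := isLocalDiffeomorphAt_lieExp (I := I) (G := G)
  refine ⟨Φ.source, Φ.open_source.mem_nhds h0, fun v hv w hw hvw => ?_⟩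
  exact Φ.injOn hv hw ((hΦ hv).symm.trans (hvw.trans (hΦ hw)))

/-- **The kernel of `exp` is discrete at `0`**: near `0 ∈ 𝔤`, `exp v = 1` only for `v = 0`
(Lee 2012, Prop. 20.8 (f)). [cite: LeeSmoothManifolds2013, Prop. 20.8 (f)] -/
theorem eventually_lieExp_eq_one_imp_eq_zero [Group G] [LieGroup I ∞ G] [T2Space G] :
    ∀ᶠ v in 𝓝 (0 : E), lieExp (I := I) (G := G) v = 1 → v = 0 := by
  obtain ⟨U, hU, hinj⟩ := exists_nhds_injOn_lieExp (I := I) (G := G)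
  filter_upwards [hU] with v hv h1
  exact hinj hv (mem_of_mem_nhds hU) (h1.trans (lieExp_zero (I := I) (G := G)).symm)

/-- **The exponential map of a connected commutative Lie group is surjective** (Lee 2012,
Problem 21-20 (a)): its range is a subgroup (`lieExp_add`, `lieExp_neg`) containing a neighbourhood
of `1`, hence everything (`subgroupClosure_range_lieExp`). [cite: LeeSmoothManifolds2013, Problem 21-20 (a)] -/
theorem lieExp_surjective [CommGroup G] [LieGroup I ∞ G] [T2Space G] [ConnectedSpace G] :
    Function.Surjective (fun v : E => lieExp (I := I) (G := G) v) := by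
  let K : Subgroup G :=
    { carrier := range (fun v : E => lieExp (I := I) (G := G) v)
      mul_mem' := by
        rintro _ _ ⟨v, rfl⟩ ⟨w, rfl⟩
        exact ⟨v + w, lieExp_add (I := I) (G := G) v w⟩
      one_mem' := ⟨0, lieExp_zero (I := I) (G := G)⟩
      inv_mem' := by
        rintro _ ⟨v, rfl⟩
        exact ⟨-v, lieExp_neg (I := I) (G := G) v⟩ }
  have hle : Subgroup.closure (range (fun v : E => lieExp (I := I) (G := G) v)) ≤ K :=
    (Subgroup.closure_le K).2 fun x hx => hx
  rw [subgroupClosure_range_lieExp] at hle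
  intro g
  exact hle (Subgroup.mem_top g)

/-- **`exp` of a commutative Lie group is an open map** (from Prop. 20.8 (f) at `0`, transported
by `exp (v + h) = exp v * exp h` and the homeomorphisms `h ↦ v + h`, `g ↦ exp v * g`).
[cite: LeeSmoothManifolds2013, Prop. 20.8 (f)] -/
theorem isOpenMap_lieExp [CommGroup G] [LieGroup I ∞ G] [T2Space G] :
    IsOpenMap (fun v : E => lieExp (I := I) (G := G) v) := by
  have hG : IsTopologicalGroup G := topologicalGroup_of_lieGroup I ∞
  obtain ⟨Φ, h0, hΦ⟩ := isLocalDiffeomorphAt_lieExp (I := I) (G := G)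
  have h1 : Filter.map (fun v : E => lieExp (I := I) (G := G) v) (𝓝 0) = 𝓝 (1 : G) := by
    have hev : (fun v : E => lieExp (I := I) (G := G) v) =ᶠ[𝓝 0] Φ :=
      Filter.eventuallyEq_of_mem (Φ.open_source.mem_nhds h0) hΦ
    rw [Filter.map_congr hev]
    have h2 := Φ.toOpenPartialHomeomorph.map_nhds_eq h0
    have h3 : (Φ.toOpenPartialHomeomorph : E → G) = Φ := rfl
    rw [h3] at h2
    rw [h2, ← hΦ h0]
    exact congrArg _ (lieExp_zero (I := I) (G := G))
  refine IsOpenMap.of_nhds_le fun v => ?_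
  have hfun : (fun v' : E => lieExp (I := I) (G := G) v') ∘ (fun h : E => v + h) =
      (fun g : G => lieExp (I := I) (G := G) v * g) ∘ (fun h : E => lieExp (I := I) (G := G) h) := by
    funext h
    exact lieExp_add (I := I) (G := G) v h
  calc 𝓝 (lieExp (I := I) (G := G) v)
      = Filter.map (fun g : G => lieExp (I := I) (G := G) v * g) (𝓝 1) :=
        (map_mul_left_nhds_one _).symm
    _ = Filter.map (fun g : G => lieExp (I := I) (G := G) v * g)
          (Filter.map (fun h : E => lieExp (I := I) (G := G) h) (𝓝 0)) := by rw [h1]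
    _ = Filter.map ((fun v' : E => lieExp (I := I) (G := G) v') ∘ (fun h : E => v + h)) (𝓝 0) := by
        rw [Filter.map_map, hfun]
    _ = Filter.map (fun v' : E => lieExp (I := I) (G := G) v')
          (Filter.map (fun h : E => v + h) (𝓝 0)) := by rw [Filter.map_map]
    _ = Filter.map (fun v' : E => lieExp (I := I) (G := G) v') (𝓝 v) := by
        rw [map_add_left_nhds_zero]
    _ ≤ Filter.map (fun v' : E => lieExp (I := I) (G := G) v') (𝓝 v) := le_rfl

end ConnectedCommutative

end Literature.Geometry.Manifold
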